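import Literature.NumberTheory.GaloisCohomology.RestrictedRamificationFiniteCohomologyBaseChange
import Literature.NumberTheory.IwasawaTheory.Greenberg2006.CohomologyCofiniteGenerationHolds
import HarnessLib

/-!
# Greenberg 2006, Prop. 3.2 (`prop32_cohomology_isCofinitelyGenerated`) DISCHARGED — every number field,
# every prime

Topic `NumberTheory/IwasawaTheory/Greenberg2006`; namespace
`Literature.NumberTheory.IwasawaTheory.Greenberg2006`.  THEOREMS ONLY (no definition, no named fact, no
`sorry`, no instance; D-0026).  Width seat `bsd-line-x2-p2` g15 (cell `bsd-eis`, crux 4 `BSDpOnCellC`,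
stmt-BirchSwinnertonDyer-19034, `--supports`).

R. Greenberg, *On the structure of certain Galois cohomology groups*, Doc. Math. Extra Vol. Coates (2006),
§3 A Prop. 3.2 (p. 358): "`Hⁱ(K_Σ/K, 𝒟)` and `Hⁱ(K_v, 𝒟)` are cofinitely generated `Λ`-modules" (for a
cofinitely generated discrete `Λ`-module `𝒟` with a continuous `Λ`-linear action of `G_{K,Σ}`,
`Λ ≅ ℤ_p⟦T₁, …, T_m⟧`).  The tree reduced the named fact `prop32_cohomology_isCofinitelyGenerated` to
Greenberg's standing hypothesis (ii) = NSW (8.3.20) / Harari Cor. 17.17 at EVERY number field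
(`prop32_cohomology_isCofinitelyGenerated_of_finite_restrictedCohomology`,
`CohomologyCofiniteGenerationHolds.lean`; the local clause `prop32_local_holds` is unconditional), and
(8.3.20) is now the tree theorem `GaloisCohomology.forall_finite_restrictedCohomology`
(`RestrictedRamificationFiniteCohomologyBaseChange.lean`: fields with real places reached by base change
of `G_{K,S}` to the totally complex cyclotomic layer `K(ζ_q) ⊆ K_S`).  Hence:

* **`prop32_cohomology_isCofinitelyGenerated_holds : prop32_cohomology_isCofinitelyGenerated`**;
* the per-field pair `prop32_at` (the shape of `prop32_of_finite_restrictedCohomology_at`, no hypothesis).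

CONSUMERS.  Every `(h32 : prop32_cohomology_isCofinitelyGenerated)` binder in the tree (cell `bsd-eis`
cruxes 2 and 4: `…AcTwistDeformation*`, `…BSDpOnCellC*`, `…AcDescent*`; cell `bsd-ssimc`
`…SignedBaseChangeAnticyclotomicEisensteinDivisibility*`; lines `crystal` / `conglim` / `halves` / `bdpline`)
is fed by `prop32_cohomology_isCofinitelyGenerated_holds`; on line `crystal` of crux 4 the registered
`stub_publishedFacts` loses one PUB conjunct (25 → 24) with NO consumer re-typing.

HONEST FRAMING: a published theorem (Greenberg 2006 Prop. 3.2, resting on NSW (8.3.20)) is now a tree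
theorem; no statement of any Summit, no case of BSD, no crux and no stub is proved here; 0 cells /
labels / tiers move.

## References
* R. Greenberg, *On the structure of certain Galois cohomology groups*, Doc. Math. Extra Vol. Coates
  (2006) 335–391, Prop. 3.2 (p. 358). [Greenberg2006]
* J. Neukirch, A. Schmidt, K. Wingberg, *Cohomology of Number Fields*, 2nd ed. (2008), (8.3.20).
  [NeukirchSchmidtWingberg2008]
* D. Harari, *Galois Cohomology and Class Field Theory* (2020), Cor. 17.17. [Harari2020]
-/

noncomputable section

open NumberField IsDedekindDomain Field
open scoped NumberField

namespace Literature.NumberTheory.IwasawaTheory.Greenberg2006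

open Literature.NumberTheory.GaloisRepresentations
open Literature.NumberTheory.GaloisCohomology
open Literature.NumberTheory.IwasawaTheory.Greenberg2016

/-- **GREENBERG 2006, PROP. 3.2 HOLDS** (the named fact `prop32_cohomology_isCofinitelyGenerated`, every
prime `p`, every number field `K`, every finite `Σ ⊇ Σ_p`, every `Λ ≅ ℤ_p⟦T₁,…,T_m⟧`, every cofinitely
generated discrete `p`-primary `Λ[G_{K,Σ}]`-module `𝒟`): `Hⁱ(K_Σ/K, 𝒟)` and `Hⁱ(K_v, 𝒟)` are cofinitely
generated `Λ`-modules for every `i`.  (Tree: Prop. 3.2 ⟸ NSW (8.3.20) at every number field ⟸ base change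
to `K(ζ_q)` + the totally complex case.) [cite: Greenberg2006, Prop. 3.2 (p. 358)]
[cite: NeukirchSchmidtWingberg2008, (8.3.20)] [cite: Harari2020, Cor. 17.17] -/
theorem prop32_cohomology_isCofinitelyGenerated_holds : prop32_cohomology_isCofinitelyGenerated :=
  prop32_cohomology_isCofinitelyGenerated_of_finite_restrictedCohomology
    forall_finite_restrictedCohomology

/-- **Per-field form, no hypothesis**: the conclusion of `prop32_cohomology_isCofinitelyGenerated` at given
binders over ONE number field `K` (the shape of `prop32_of_finite_restrictedCohomology_at`).
[cite: Greenberg2006, Prop. 3.2 (p. 358)] [cite: NeukirchSchmidtWingberg2008, (8.3.20)] -/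
theorem prop32_at {K : Type} [Field K] [NumberField K] {p : ℕ} [Fact p.Prime]
    (S : Set (HeightOneSpectrum (𝓞 K))) (hS : S.Finite)
    (hSp : ∀ v : HeightOneSpectrum (𝓞 K), ((p : ℕ) : 𝓞 K) ∈ v.asIdeal → v ∈ S)
    {Λ : Type} [CommRing Λ] [TopologicalSpace Λ] [IsTopologicalRing Λ] {mΛ : ℕ}
    (e : Λ ≃+* MvPowerSeries (Fin mΛ) ℤ_[p])
    {D : Type} [AddCommGroup D] [Module Λ D] [TopologicalSpace D] [DiscreteTopology D]
    [ContinuousSMul Λ D] (ρ : ContinuousRep (GaloisGroupUnramifiedOutside K S) Λ D)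
    (hD : IsCofinitelyGenerated Λ D) :
    (∀ i : ℕ, IsCofinitelyGenerated Λ (ρ.H i)) ∧
      ∀ (v : NumberField.Place K) (i : ℕ), IsCofinitelyGenerated Λ ((localRep S ρ v).H i) :=
  prop32_of_finite_restrictedCohomology_at (finite_restrictedCohomology_holds K) S hS hSp e ρ hD

end Literature.NumberTheory.IwasawaTheory.Greenberg2006

end
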